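import Summits.QuantumFields.YangMills.Theorems.FradkinShenkerFlowFiniteSusceptibilityWeakCouplingSiblingFunnel
import HarnessLib

/-!
# Reflection positivity of the mirror-diagonal summands (crux `FiniteSusceptibilityWeakCoupling`, item stmt-QuantumFields-9442)

Support file for item stmt-QuantumFields-9442 (route `FradkinShenkerFlow` of `YangMills`), line
`sup-axis-reflection-transfer`. Since the c5 reshape the line's single open stub `stub_mirrorCubicMoment` asks, for
compact simple `G`, faithful unitary `r` and `β ≥ β₀(G, r)`, that every gauge-invariant local observable `A` have
`Σ_{n ≤ S} (n+1)³ |⟨A · τ_{n e₀}(A∘Θ)⟩_{β,2S+1} − ⟨A⟩⟨A∘Θ⟩|` bounded uniformly in the odd torus (`Θ = cfgReflect`, the `ℤ⁴`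
time reflection). This file records, kernel-checked, the structural fact quoted in its docstring: at every `β ≥ 0` and
for every compact `G`, the summands at ODD lags `n = 2p + 1` beyond the time radius of `supp A` (and up to `S`) are
NON-NEGATIVE — they are the reflection-positive quantities `Cov_S(F∘Θ_p, F)`, `F = (A∘Θ)∘τ_{-(2p+1)e₀}∘lift`, of the odd
torus for the reflection through the link hyperplane `t = p + ½` (landed `stub_rpCauchySchwarz stub_oddTorusRP`). So,
up to finitely many lags per `A` and the even lags, the open stub bounds a sum of non-negative terms: the spectral
("fourth resolvent moment") reading `Σ_p (2p+2)³ ⟨Â, T^{2p+1} ΘÂ⟩` is literal.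

* `MirrorPositivity.mirrorCov_nonneg` — covariance form;
* `mirrorCorr_nonneg_oddLag` / registered `stub_mirrorCorrNonneg` — `latticeConnectedCorr` form (the vocabulary of the
  open stub).

No definition is introduced; every compact `G`, every `β ≥ 0`. [folklore]
-/

noncomputable section

open MeasureTheory ProbabilityTheory Finset
open Literature.MathematicalPhysics.QuantumFieldTheory hiding Site ZdEdge
open Literature.MathematicalPhysics.QuantumLattice
open Literature.Probability.LatticeModels hiding configShift configShift_apply

namespace Summit.QuantumFields.YangMills.Theorems.FiniteSusceptibilityWeakCoupling

namespace MirrorPositivity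

open MirrorDominationAxis0

variable {G : Type} [Group G] [TopologicalSpace G] [IsTopologicalGroup G] [CompactSpace G]
  [MeasurableSpace G] [BorelSpace G]

/-- **Reflection positivity of the mirror covariance at odd lags** (every compact `G`, every `β ≥ 0`): if `R₀` bounds
the time coordinates of `supp A`, then for `R₀ + 1 ≤ p` and `p + R₀ + 1 ≤ S` (so that the translate of the mirror
species by `(2p+1) e₀` lives on links with time coordinate in the positive half `[p+1, p+S]` of the torus of side
`2S+1` for the reflection through `t = p + ½`), `0 ≤ Cov_S(A∘lift, (A∘Θ)∘τ_{-(2p+1)e₀}∘lift)`: this is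
`Cov(F∘Θ_p, F) ≥ 0` for `F = Aᴿ∘τ_{-(2p+1)e₀}∘lift` (`torusLift_theta`, `reflSpecies_F_shift_cfgReflect_shift`). [folklore] -/
theorem mirrorCov_nonneg (r : LatticeRep G) {β : ℝ} (hβ : 0 ≤ β) (A : YMSpecies G) {R₀ : ℕ}
    (hR : ∀ e ∈ A.supp, (e.1 0).natAbs ≤ R₀) {S p : ℕ} (hp : R₀ + 1 ≤ p) (hpS : p + R₀ + 1 ≤ S) :
    0 ≤ cov[fun U => A.F (torusLift (2 * S + 1) U),
        fun U => A.F (cfgReflect (configShift (-(Pi.single 0 ((2 * p + 1 : ℕ) : ℤ))) (torusLift (2 * S + 1) U)));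
        wilsonMeasure (d := 4) (L := 2 * S + 1) r.ρ β] := by
  have hdep : DependsOn (fun U : GaugeConfig 4 (2 * S + 1) G => (reflSpecies A).F
      (configShift (-(Pi.single 0 ((2 * p + 1 : ℕ) : ℤ))) (torusLift (2 * S + 1) U)))
      {e : Edge 4 (2 * S + 1) |
        WilsonOddRP.IsOPosEdge (sitePerm (1 : Equiv.Perm (Fin 4)).symm
          (e.1 - Torus.proj (2 * S + 1) (Pi.single 0 (p : ℤ))), (1 : Equiv.Perm (Fin 4)).symm e.2) ∨
        WilsonOddRP.IsOSharedEdge (sitePerm (1 : Equiv.Perm (Fin 4)).symm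
          (e.1 - Torus.proj (2 * S + 1) (Pi.single 0 (p : ℤ))), (1 : Equiv.Perm (Fin 4)).symm e.2)} := by
    refine (Negative.dependsOn_comp_configShift_torusLift (2 * S + 1) (reflSpecies A) _).mono ?_
    intro e he
    obtain ⟨e', he', rfl⟩ := Finset.mem_image.1 (Finset.mem_coe.1 he)
    obtain ⟨e'', he'', rfl⟩ := Finset.mem_image.1 he'
    have ht := hR e'' he''
    have h0 : ((reflectEdge e'').1 + (Pi.single 0 ((2 * p + 1 : ℕ) : ℤ) : Site 4)) 0 =
        (if e''.2 = 0 then -e''.1 0 - 1 else -e''.1 0) + (2 * p + 1 : ℕ) := by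
      rw [Pi.add_apply, reflectEdge_fst_zero, Pi.single_eq_same]
    refine torusEdge_mem_pos S p _ _ ?_ ?_ <;> rw [h0] <;> split_ifs <;> omega
  obtain ⟨hD₁, -, -⟩ := stub_rpCauchySchwarz stub_oddTorusRP G r.N r.ρ r.continuous β hβ S (by omega) 1
    (Torus.proj (2 * S + 1) (Pi.single 0 (p : ℤ)))
    (fun U => (reflSpecies A).F
      (configShift (-(Pi.single 0 ((2 * p + 1 : ℕ) : ℤ))) (torusLift (2 * S + 1) U)))
    (fun U => (reflSpecies A).F
      (configShift (-(Pi.single 0 ((2 * p + 1 : ℕ) : ℤ))) (torusLift (2 * S + 1) U)))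
    ((reflSpecies A).measurable.comp ((configShift _).measurable.comp (measurable_torusLift _)))
    ((reflSpecies A).measurable.comp ((configShift _).measurable.comp (measurable_torusLift _)))
    (by obtain ⟨C, hC⟩ := (reflSpecies A).bounded; exact ⟨C, fun U => hC _⟩)
    (by obtain ⟨C, hC⟩ := (reflSpecies A).bounded; exact ⟨C, fun U => hC _⟩)
    hdep hdep
  simp only [torusLift_theta, reflSpecies_F_shift_cfgReflect_shift] at hD₁
  exact hD₁

end MirrorPositivity

open MirrorPositivity MirrorDominationAxis0 in
/-- **Odd-lag summands of the open stub are non-negative** (every compact `G`, every `β ≥ 0`, `latticeConnectedCorr`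
vocabulary): for every gauge-invariant local observable `A` there is `n₁` (`= R₀ + 1`, `R₀` the time radius of
`supp A`) such that on every odd torus `2S+1` and for every `p` with `n₁ ≤ p` and `p + n₁ ≤ S` — all odd lags `2p+1`
but `O(R₀)` at either end — `0 ≤ ⟨A · τ_{(2p+1) e₀}(A∘Θ)⟩_{β,2S+1} − ⟨A⟩⟨A∘Θ⟩`. [folklore] -/
theorem mirrorCorr_nonneg_oddLag {G : Type} [Group G] [TopologicalSpace G] [IsTopologicalGroup G] [CompactSpace G]
    [MeasurableSpace G] [BorelSpace G] (r : LatticeRep G) {β : ℝ} (hβ : 0 ≤ β) (A : YMSpecies G) :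
    ∃ n₁ : ℕ, ∀ S p : ℕ, n₁ ≤ p → p + n₁ ≤ S →
      0 ≤ latticeConnectedCorr r.ρ β (2 * S + 1) A.F (fun V => A.F (cfgReflect V)) (2 * p + 1) := by
  obtain ⟨R₀, hR⟩ : ∃ R₀ : ℕ, ∀ e ∈ A.supp, (e.1 0).natAbs ≤ R₀ :=
    ⟨A.supp.sup fun e => (e.1 0).natAbs,
      fun e he => Finset.le_sup (f := fun e : ZdEdge 4 => (e.1 0).natAbs) he⟩
  refine ⟨R₀ + 1, fun S p hp hpS => ?_⟩
  have h := mirrorCov_nonneg r hβ A hR (S := S) (p := p) (by omega) (by omega)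
  have key : cov[fun U => A.F (torusLift (2 * S + 1) U),
      fun U => A.F (cfgReflect (configShift (-(Pi.single 0 ((2 * p + 1 : ℕ) : ℤ))) (torusLift (2 * S + 1) U)));
      wilsonMeasure (d := 4) (L := 2 * S + 1) r.ρ β] =
      latticeConnectedCorr r.ρ β (2 * S + 1) A.F (fun V => A.F (cfgReflect V)) (2 * p + 1) :=
    SiblingFunnel.covariance_eq_latticeConnectedCorr r β A (reflSpecies A) S (2 * p + 1)
  rwa [key] at h

/-- **Registered sub-goal `stub_mirrorCorrNonneg`** of item stmt-QuantumFields-9442 (signature verbatim, fully qualified):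
the odd-lag summands of the open stub `stub_mirrorCubicMoment` are non-negative at every `β ≥ 0`, for every compact `G`
and every lattice representation — the reflection-positivity half of its spectral reading. [folklore] -/
theorem stub_mirrorCorrNonneg : ∀ (G : Type) [Group G] [TopologicalSpace G] [IsTopologicalGroup G] [CompactSpace G] [MeasurableSpace G] [BorelSpace G] (r : Literature.MathematicalPhysics.QuantumFieldTheory.LatticeRep G) (β : ℝ), 0 ≤ β → ∀ A : Literature.MathematicalPhysics.QuantumFieldTheory.YMSpecies G, ∃ n₁ : ℕ, ∀ S p : ℕ, n₁ ≤ p → p + n₁ ≤ S → 0 ≤ Literature.MathematicalPhysics.QuantumFieldTheory.latticeConnectedCorr r.ρ β (2 * S + 1) A.F (fun V => A.F (Literature.MathematicalPhysics.QuantumFieldTheory.cfgReflect V)) (2 * p + 1) :=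
  fun _G _ _ _ _ _ _ r _β hβ A => mirrorCorr_nonneg_oddLag r hβ A


open MirrorPositivity MirrorDominationAxis0 in
/-- **Even lags fold to odd lags of the swapped pair.** On the torus of side `2S+1` the mirror correlator of `A` at an
even lag `2q ≤ 2S+1` equals the correlator of the swapped pair `(A∘Θ, A)` at the odd lag `2S+1-2q` (periodicity of the
lift, translation invariance and symmetry of the covariance: `MirrorDominationAxis0.cov_fold`). [folklore] -/
theorem mirrorCorr_evenLag_eq_fold {G : Type} [Group G] [TopologicalSpace G] [IsTopologicalGroup G] [CompactSpace G]
    [MeasurableSpace G] [BorelSpace G] (r : LatticeRep G) (β : ℝ) (A : YMSpecies G) {S q : ℕ} (hq : 2 * q ≤ 2 * S + 1) :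
    latticeConnectedCorr r.ρ β (2 * S + 1) A.F (fun V => A.F (cfgReflect V)) (2 * q) =
      latticeConnectedCorr r.ρ β (2 * S + 1) (fun V => A.F (cfgReflect V)) A.F (2 * S + 1 - 2 * q) := by
  have e1 : cov[fun U => A.F (torusLift (2 * S + 1) U),
      fun U => A.F (cfgReflect (configShift (-(Pi.single 0 ((2 * q : ℕ) : ℤ))) (torusLift (2 * S + 1) U)));
      wilsonMeasure (d := 4) (L := 2 * S + 1) r.ρ β] =
      latticeConnectedCorr r.ρ β (2 * S + 1) A.F (fun V => A.F (cfgReflect V)) (2 * q) :=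
    SiblingFunnel.covariance_eq_latticeConnectedCorr r β A (reflSpecies A) S (2 * q)
  have e2 : cov[fun U => A.F (cfgReflect (torusLift (2 * S + 1) U)),
      fun U => A.F (configShift (-(Pi.single 0 ((2 * S + 1 - 2 * q : ℕ) : ℤ))) (torusLift (2 * S + 1) U));
      wilsonMeasure (d := 4) (L := 2 * S + 1) r.ρ β] =
      latticeConnectedCorr r.ρ β (2 * S + 1) (fun V => A.F (cfgReflect V)) A.F (2 * S + 1 - 2 * q) :=
    SiblingFunnel.covariance_eq_latticeConnectedCorr r β (reflSpecies A) A S (2 * S + 1 - 2 * q)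
  rw [← e1, ← e2]
  exact cov_fold r.ρ β A.F (reflSpecies A).F hq

open MirrorPositivity MirrorDominationAxis0 in
/-- **All summands of the open stub beyond the support scale are non-negative** (every compact `G`, every `β ≥ 0`):
for every gauge-invariant local observable `A` there is `n₂` such that on every odd torus `2S+1` and for every lag `n`
with `n₂ ≤ n ≤ S`, `0 ≤ ⟨A · τ_{n e₀}(A∘Θ)⟩_{β,2S+1} − ⟨A⟩⟨A∘Θ⟩`. Odd lags: `mirrorCorr_nonneg_oddLag` (reflection through
a link plane); even lags `2q`: fold to the odd lag `2(S-q)+1` of the swapped pair `(Aᴿ, A) = (Aᴿ, (Aᴿ)ᴿ)`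
(`mirrorCorr_evenLag_eq_fold`, `cfgReflect_cfgReflect`) and apply the odd case to the mirror species `Aᴿ` — on the odd
torus every reflection is a link-plane AND a site-plane reflection. So, within
the stub's range `n ≤ S`, only the finitely many lags `n < n₂(A)` (weight `≤ (n₂)³`, `|·| ≤ 4‖A‖∞²`) can be negative: the
open stub `stub_mirrorCubicMoment` is, up to a bounded term, the supremum over `S` of a sum of NON-NEGATIVE terms. [folklore] -/
theorem mirrorCorr_nonneg_eventually {G : Type} [Group G] [TopologicalSpace G] [IsTopologicalGroup G] [CompactSpace G]
    [MeasurableSpace G] [BorelSpace G] (r : LatticeRep G) {β : ℝ} (hβ : 0 ≤ β) (A : YMSpecies G) :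
    ∃ n₂ : ℕ, ∀ S n : ℕ, n₂ ≤ n → n ≤ S →
      0 ≤ latticeConnectedCorr r.ρ β (2 * S + 1) A.F (fun V => A.F (cfgReflect V)) n := by
  obtain ⟨n₁, h₁⟩ := mirrorCorr_nonneg_oddLag r hβ A
  obtain ⟨m₁, h₂⟩ := mirrorCorr_nonneg_oddLag r hβ (reflSpecies A)
  have hR : (reflSpecies A).F = fun V => A.F (cfgReflect V) := rfl
  refine ⟨2 * n₁ + 2 * m₁ + 1, fun S n hn hnS => ?_⟩
  obtain ⟨q, rfl | rfl⟩ := Nat.even_or_odd' n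
  · -- even lag `2q`: fold to the odd lag `2(S - q) + 1` of `Aᴿ`
    rw [mirrorCorr_evenLag_eq_fold r β A (by omega)]
    have hS : 2 * S + 1 - 2 * q = 2 * (S - q) + 1 := by omega
    rw [hS]
    simpa only [hR, cfgReflect_cfgReflect] using h₂ S (S - q) (by omega) (by omega)
  · -- odd lag `2q + 1`
    exact h₁ S q (by omega) (by omega)

end Summit.QuantumFields.YangMills.Theorems.FiniteSusceptibilityWeakCoupling
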